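import Literature.MathematicalPhysics.QuantumLattice.StabilityRotatedDecompositionProofs
import Literature.MathematicalPhysics.QuantumLattice.SpectralSmoothingProofs
import Literature.MathematicalPhysics.QuantumLattice.SpectralFilterProofs
import HarnessLib

/-!
# `michalakis_zwolak` from the spectral flow and the locality estimates, with concrete smoothing

Top-down layer (seat B) of the formalisation of the Michalakis–Zwolak stability theorem
(hubbard.S19, `Literature.MathematicalPhysics.QuantumLattice.michalakis_zwolak`). The reduction
`michalakis_zwolak_of_flow_decomposition_core` (`StabilityRotatedDecompositionProofs`) still
asked for abstract smoothing maps `F_s`, `F₀` with the properties of MZ13 Lemma 1 (i)–(ii). Here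
they are instantiated with the concrete maps of Michalakis–Zwolak, arXiv:1109.1588 §5.1,
`𝓕^s(O) = ∫ w(t) τ_t^{H_s}(O) dt` and `𝓕⁰(O) = ∫ w(t) τ_t^{H₀}(O) dt` for a Schwartz filter `w`
with `∫ w = 1` and `ŵ` vanishing off the gap `γ/2` (`exists_schwartz_filter`), and their
properties are *discharged* from `SpectralSmoothingProofs` (seat A): additivity and homogeneity
of the Bochner integral, `𝓕(H) = H` (`integral_smul_heisenbergEvolution_self`, Lemma 1 (i)), and
`[𝓕(O), P] = 0` for a spectral projection separated by `γ/2`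
(`commute_integral_smul_heisenbergEvolution_projMatrix`, Lemma 1 (ii)); for `H₀` the separated
projection onto the eigenvalues `≤ 0` is `P₀` (`localGroundProj_univ_eq_projMatrix_span`).

The resulting reduction `michalakis_zwolak_of_flow_locality_core` leaves to the analytic side,
for every Schwartz filter with these two properties and for `|ε| ≤ 1`, `L ≥ L_A`, `s ∈ [0,1]` with
the `γ/2`-gap along `[0, s]`:

* **the spectral flow**: a unitary `U` and a `γ/2`-separated set `S` of eigen-indices of `H_s`
  with `U⋆ P_S U = P₀` (`hasDerivAt_clusterProj`, `exists_unitary_flow`);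
* **the locality estimates** (MZ13 Lemma 1 (v) and Lemma 2): term-wise Hermitian decompositions
  of `U⋆ 𝓕^s(Φ Z) U − 𝓕⁰(Φ Z)` (norm `≤ |ε| B_p/(ℓ+1)^p`) and of `U⋆ 𝓕^s(V Z) U`
  (norm `≤ B_p/(ℓ+1)^p`) on the balls `cellBall (c Z) ℓ`, `ℓ ≤ L`, about centres with
  `Z ⊆ cellBall (c Z) r₀` (resp. `r`).

No definitions, no named facts (theorems only).
-/

noncomputable section

open Matrix Finset Module MeasureTheory Complex
open scoped InnerProductSpace ComplexOrder Matrix.Norms.L2Operator SchwartzMap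

namespace Literature.MathematicalPhysics.QuantumLattice

open Literature.Probability.LatticeModels

/-! ### The smoothing map is additive and homogeneous -/

section Smoothing

variable {n : Type*} [Fintype n] [DecidableEq n]

/-- The Heisenberg evolution is additive in the observable. [folklore] -/
theorem heisenbergEvolution_add_obs (H : Matrix n n ℂ) (t : ℝ) (A B : Matrix n n ℂ) :
    heisenbergEvolution H t (A + B) = heisenbergEvolution H t A + heisenbergEvolution H t B := by
  simp only [heisenbergEvolution, Matrix.mul_add, Matrix.add_mul]

/-- The Heisenberg evolution is homogeneous in the observable. [folklore] -/
theorem heisenbergEvolution_smul_obs (H : Matrix n n ℂ) (t : ℝ) (a : ℂ) (A : Matrix n n ℂ) :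
    heisenbergEvolution H t (a • A) = a • heisenbergEvolution H t A := by
  simp only [heisenbergEvolution, Matrix.mul_smul, Matrix.smul_mul]

/-- **The smoothing map `O ↦ ∫ w(t) • τ_t(O) dt` is additive.** [folklore] -/
theorem integral_smul_heisenbergEvolution_add {H : Matrix n n ℂ} (hH : H.IsHermitian)
    {w : ℝ → ℂ} (hw : Integrable w) (A B : Matrix n n ℂ) :
    (∫ t : ℝ, w t • heisenbergEvolution H t (A + B)) =
      (∫ t : ℝ, w t • heisenbergEvolution H t A) + ∫ t : ℝ, w t • heisenbergEvolution H t B := by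
  rw [← integral_add (integrable_smul_heisenbergEvolution hH hw A)
    (integrable_smul_heisenbergEvolution hH hw B)]
  refine integral_congr_ae (Filter.Eventually.of_forall fun t => ?_)
  simp only [heisenbergEvolution_add_obs, smul_add]

/-- **The smoothing map is homogeneous.** [folklore] -/
theorem integral_smul_heisenbergEvolution_smul (H : Matrix n n ℂ) (w : ℝ → ℂ) (a : ℂ)
    (A : Matrix n n ℂ) :
    (∫ t : ℝ, w t • heisenbergEvolution H t (a • A)) =
      a • ∫ t : ℝ, w t • heisenbergEvolution H t A := by
  rw [← integral_smul]
  refine integral_congr_ae (Filter.Eventually.of_forall fun t => ?_)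
  simp only [heisenbergEvolution_smul_obs, smul_comm (w t) a]

end Smoothing

/-! ### `H₀`: the separated projection onto the eigenvalues `≤ 0` -/

section GroundCluster

variable {d L : ℕ} [NeZero L] {κ : Type*} [Fintype κ] [DecidableEq κ] {q : ℕ}

/-- For a projector interaction with `HasClusterGap H_univ m 0 γ`, the eigen-indices with
`λ ≤ 0` are `γ`-separated from the others (all eigenvalues are `≥ 0`, and those `> 0` are
`≥ E₀ + γ ≥ γ`). [folklore] -/
theorem separated_ground_indices {Φ : Interaction (TorusSite d L × κ) q}
    (hΦ : IsProjectorInteraction Φ) {m : ℕ} {γ : ℝ}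
    (hgap : (localHamiltonian Φ univ).HasClusterGap m 0 γ)
    (hH : (localHamiltonian Φ univ).IsHermitian) :
    ∀ k ∈ ({k | hH.eigenvalues k ≤ 0} : Finset (TensorIndex (TorusSite d L × κ) q)),
      ∀ l ∉ ({k | hH.eigenvalues k ≤ 0} : Finset (TensorIndex (TorusSite d L × κ) q)),
        γ ≤ |hH.eigenvalues k - hH.eigenvalues l| := by
  intro k hk l hl
  simp only [Finset.mem_filter, Finset.mem_univ, true_and, not_le] at hk hl
  have hnn : ∀ i, 0 ≤ hH.eigenvalues i := (hΦ.posSemidef_localHamiltonian univ).eigenvalues_nonneg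
  obtain ⟨_, -, hγ, -, hsep⟩ := hgap
  have hbdd : BddBelow (Set.range hH.eigenvalues) := (Set.finite_range _).bddBelow
  have hE0 : 0 ≤ ⨅ j, hH.eigenvalues j := by
    haveI : Nonempty (TensorIndex (TorusSite d L × κ) q) := ⟨k⟩
    exact le_ciInf hnn
  have hk0 : hH.eigenvalues k = 0 := le_antisymm hk (hnn k)
  rcases hsep l with h | h
  · rw [add_zero] at h
    exact absurd ((ciInf_le hbdd k).trans_eq hk0) (not_le.mpr (hl.trans_le h))
  · rw [add_zero] at h
    rw [hk0, zero_sub, abs_neg, abs_of_nonneg (hnn l)]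
    linarith

end GroundCluster

/-! ### The reduction with concrete smoothing maps -/

section Core

universe u

variable (d q : ℕ) {κ : Type u} [Fintype κ] [DecidableEq κ]

/-- **`michalakis_zwolak` from the spectral flow and the locality estimates.** See the module
docstring: the hypothesis `hS` is what remains of the printed proof of Michalakis–Zwolak after
this session's layers — the existence of Hastings' spectral flow `U(s)` intertwining a
`γ/2`-separated spectral projection of `H_s` with `P₀`, and the term-wise quasi-locality (with
`O(ε)` control) of `U⋆ 𝓕^s(Φ Z) U − 𝓕⁰(Φ Z)` and `U⋆ 𝓕^s(V Z) U` for the concrete smoothing maps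
`𝓕^s`, `𝓕⁰` of a Schwartz filter (MZ13 Lemma 1 (v), Lemma 2; arXiv:1109.1588 pp. 9–12).
[cite: MichalakisZwolakCMP2013, Thm. 1, §5.1–5.2 (arXiv:1109.1588 pp. 6–12)] -/
theorem michalakis_zwolak_of_flow_locality_core
    (hS : ∀ (Φ : (L : ℕ) → Interaction (TorusSite d L × κ) q) (m : ℕ → ℕ) (γ : ℝ) (r₀ : ℕ)
      (Δ γloc : ℕ → ℝ),
      (∀ (L : ℕ) [NeZero L], IsProjectorInteraction (Φ L) ∧ (Φ L).IsLocal) →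
      (∀ (L : ℕ) [NeZero L], IsFrustrationFree (Φ L) univ) →
      (∀ (L : ℕ) [NeZero L] (X : Finset (TorusSite d L × κ)), r₀ < torusDiam X → Φ L X = 0) →
      (0 < γ ∧ ∀ (L : ℕ) [NeZero L], (localHamiltonian (Φ L) univ).HasClusterGap (m L) 0 γ) →
      HasUniformLTQO Φ Δ → HasFastDecay Δ → HasUniformLocalGap Φ γloc →
      (∃ c : ℝ, ∃ p : ℕ, 0 < c ∧ ∀ ℓ : ℕ, c / ((ℓ : ℝ) + 1) ^ p ≤ γloc ℓ) →
      ∀ (r : ℕ) (V : (L : ℕ) → Interaction (TorusSite d L × κ) q),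
        (∀ (L : ℕ) [NeZero L], (V L).IsLocal ∧
          (∀ X, r < torusDiam X → V L X = 0) ∧ ∀ X, ‖V L X‖ ≤ 1) →
        ∃ L_A : ℕ, ∃ Bd : ℕ → ℝ,
          ∀ w : 𝓢(ℝ, ℂ), (∫ t : ℝ, w t) = 1 →
            (∀ D : ℝ, γ / 2 ≤ |D| → ∫ t : ℝ, cexp (t * D * I) * w t = 0) →
            (∀ t : ℝ, starRingEnd ℂ (w t) = w t) →
          ∀ ε : ℝ, |ε| ≤ 1 → ∀ (L : ℕ) [NeZero L], L_A ≤ L → ∀ s ∈ Set.Icc (0 : ℝ) 1,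
            (∀ t ∈ Set.Icc (0 : ℝ) s, ∃ ω : ℝ, ω ≤ γ ∧
              (localHamiltonian (Φ L) univ +
                (t : ℂ) • ((ε : ℂ) • localHamiltonian (V L) univ)).HasClusterGap (m L) ω (γ / 2)) →
            ∃ (U : Op (TorusSite d L × κ) q) (S : Finset (TensorIndex (TorusSite d L × κ) q))
              (c₁ c₂ : Finset (TorusSite d L × κ) → TorusSite d L)
              (A B : Finset (TorusSite d L × κ) → ℕ → Op (TorusSite d L × κ) q),
              U ∈ unitary (Op (TorusSite d L × κ) q) ∧
              (∀ hHs : (∑ Z, Φ L Z + ((s * ε : ℝ) : ℂ) • ∑ Z, V L Z).IsHermitian,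
                (∀ k ∈ S, ∀ l ∉ S, γ / 2 ≤ |hHs.eigenvalues k - hHs.eigenvalues l|) ∧
                star U * projMatrix (Submodule.span ℂ (Set.range fun i : S =>
                  hHs.eigenvectorBasis i)) * U = localGroundProj (Φ L) univ) ∧
              (∀ Z, Φ L Z ≠ 0 → Z ⊆ cellBall (c₁ Z) r₀) ∧
              (∀ Z, V L Z ≠ 0 → Z ⊆ cellBall (c₂ Z) r) ∧
              (∀ Z, Φ L Z ≠ 0 → ∑ ℓ ∈ range (L + 1), A Z ℓ =
                star U * (∫ t : ℝ, w t • heisenbergEvolution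
                  (∑ Z, Φ L Z + ((s * ε : ℝ) : ℂ) • ∑ Z, V L Z) t (Φ L Z)) * U -
                  ∫ t : ℝ, w t • heisenbergEvolution (∑ Z, Φ L Z) t (Φ L Z)) ∧
              (∀ Z, V L Z ≠ 0 → ∑ ℓ ∈ range (L + 1), B Z ℓ =
                star U * (∫ t : ℝ, w t • heisenbergEvolution
                  (∑ Z, Φ L Z + ((s * ε : ℝ) : ℂ) • ∑ Z, V L Z) t (V L Z)) * U) ∧
              (∀ Z ℓ, IsSupportedOn (A Z ℓ) (cellBall (c₁ Z) ℓ)) ∧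
              (∀ Z ℓ, IsSupportedOn (B Z ℓ) (cellBall (c₂ Z) ℓ)) ∧
              (∀ Z ℓ, (A Z ℓ).IsHermitian) ∧ (∀ Z ℓ, (B Z ℓ).IsHermitian) ∧
              (∀ Z ℓ (p : ℕ), ‖A Z ℓ‖ ≤ |ε| * (Bd p / ((ℓ : ℝ) + 1) ^ p)) ∧
              (∀ Z ℓ (p : ℕ), ‖B Z ℓ‖ ≤ Bd p / ((ℓ : ℝ) + 1) ^ p)) :
    michalakis_zwolak (κ := κ) d q := by
  refine michalakis_zwolak_of_flow_decomposition_core d q ?_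
  intro Φ m γ r₀ Δ γloc hproj hff hrange hgap hltqo hΔ hloc hγloc r V hV
  obtain ⟨L_A, Bd, hcore⟩ := hS Φ m γ r₀ Δ γloc hproj hff hrange hgap hltqo hΔ hloc hγloc r V hV
  have hγ : 0 < γ := hgap.1
  obtain ⟨w, hw1, hw2, hw3⟩ := exists_schwartz_filter (half_pos hγ)
  refine ⟨L_A, Bd, ?_⟩
  intro ε hε L _ hL s hs hprev
  obtain ⟨U, S, c₁, c₂, A, B, hU, hflow, hc₁, hc₂, hAsum, hBsum, hAs, hBs, hAh, hBh, hAn, hBn⟩ :=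
    hcore w hw1 hw2 hw3 ε hε L hL s hs hprev
  -- the Hamiltonians and their hermiticity
  set H₀ : Op (TorusSite d L × κ) q := ∑ Z, Φ L Z with hH₀def
  set Hs : Op (TorusSite d L × κ) q := ∑ Z, Φ L Z + ((s * ε : ℝ) : ℂ) • ∑ Z, V L Z with hHsdef
  have hH₀eq : localHamiltonian (Φ L) univ = H₀ := localHamiltonian_univ_eq_sum _
  have hH₀h : H₀.IsHermitian := by
    rw [← hH₀eq]; exact localHamiltonian_isHermitian (hproj L).2 univ
  have hV₁h : (∑ Z, V L Z).IsHermitian := by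
    rw [← localHamiltonian_univ_eq_sum]; exact localHamiltonian_isHermitian (hV L).1 univ
  have hHsh : Hs.IsHermitian := hH₀h.add (isHermitian_ofReal_smul hV₁h _)
  obtain ⟨hsep, hUP⟩ := hflow hHsh
  have hwi : Integrable (fun t : ℝ => w t) := w.integrable
  -- the smoothing maps
  set Fs : Op (TorusSite d L × κ) q → Op (TorusSite d L × κ) q :=
    fun O => ∫ t : ℝ, w t • heisenbergEvolution Hs t O with hFsdef
  set F0 : Op (TorusSite d L × κ) q → Op (TorusSite d L × κ) q :=
    fun O => ∫ t : ℝ, w t • heisenbergEvolution H₀ t O with hF0def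
  set Ps : Op (TorusSite d L × κ) q :=
    projMatrix (Submodule.span ℂ (Set.range fun i : S => hHsh.eigenvectorBasis i)) with hPsdef
  refine ⟨U, Ps, Fs, F0, c₁, c₂, A, B, hU, hUP, ?_, ?_, ?_, ?_, ?_, ?_, ?_, ?_, hc₁, hc₂,
    ?_, ?_, hAs, hBs, hAh, hBh, hAn, hBn⟩
  · exact fun X Y => integral_smul_heisenbergEvolution_add hHsh hwi X Y
  · exact fun a X => integral_smul_heisenbergEvolution_smul Hs w a X
  · -- `𝓕^s(H_s) = H_s`
    show (∫ t : ℝ, w t • heisenbergEvolution Hs t Hs) = Hs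
    rw [integral_smul_heisenbergEvolution_self, hw1, one_smul]
  · exact fun O => commute_integral_smul_heisenbergEvolution_projMatrix hHsh hwi hw2 S hsep O
  · exact fun X Y => integral_smul_heisenbergEvolution_add hH₀h hwi X Y
  · exact fun a X => integral_smul_heisenbergEvolution_smul H₀ w a X
  · show (∫ t : ℝ, w t • heisenbergEvolution H₀ t H₀) = H₀
    rw [integral_smul_heisenbergEvolution_self, hw1, one_smul]
  · -- `[𝓕⁰(O), P₀] = 0`: `P₀` is the separated projection onto the eigenvalues `≤ 0`
    intro O
    have hgapL : (localHamiltonian (Φ L) univ).HasClusterGap (m L) 0 γ := hgap.2 L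
    have hHh' : (localHamiltonian (Φ L) univ).IsHermitian :=
      localHamiltonian_isHermitian (hproj L).2 univ
    have hsep0 := separated_ground_indices (hproj L).1 hgapL hHh'
    have hsep0' : ∀ k ∈ ({k | hHh'.eigenvalues k ≤ 0} : Finset (TensorIndex (TorusSite d L × κ) q)),
        ∀ l ∉ ({k | hHh'.eigenvalues k ≤ 0} : Finset (TensorIndex (TorusSite d L × κ) q)),
          γ / 2 ≤ |hHh'.eigenvalues k - hHh'.eigenvalues l| :=
      fun k hk l hl => (half_le_self hγ.le).trans (hsep0 k hk l hl)
    have hc := commute_integral_smul_heisenbergEvolution_projMatrix hHh' hwi hw2 _ hsep0' O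
    -- identify the separated projection with `P₀`
    have hP0 : localGroundProj (Φ L) univ = projMatrix (Submodule.span ℂ (Set.range fun i :
        ({k | hHh'.eigenvalues k ≤ 0} : Finset (TensorIndex (TorusSite d L × κ) q)) =>
          hHh'.eigenvectorBasis i)) := by
      rcases isEmpty_or_nonempty (TensorIndex (TorusSite d L × κ) q) with hemp | hne
      · exact Subsingleton.elim _ _
      · obtain ⟨c₀, p₀, hc₀, hγloc'⟩ := hγloc
        exact localGroundProj_univ_eq_projMatrix_span (hproj L).1 (hloc L) hHh' le_rfl
          (lt_of_lt_of_le (by positivity) (hγloc' L))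
    rw [hP0]
    show Commute (∫ t : ℝ, w t • heisenbergEvolution H₀ t O) _
    rw [← hH₀eq]
    exact hc
  · intro Z hZ
    exact hAsum Z hZ
  · intro Z hZ
    exact hBsum Z hZ

/-- **`michalakis_zwolak` from the spectral flow and the locality estimates (constants
depending on the filter).** The same reduction as `michalakis_zwolak_of_flow_locality_core`, with
the quantifiers in the usable order: the Schwartz filter `w` is fixed FIRST and the threshold
`L_A` and the envelope `Bd` may depend on it (in `michalakis_zwolak_of_flow_locality_core` they
were asked uniformly in `w`, which no provider can supply since the smoothed terms are linear in
`w`). The proof is identical: the reduction chooses one filter (`exists_schwartz_filter`) once and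
for all. [cite: MichalakisZwolakCMP2013, Thm. 1, §5.1–5.2 (arXiv:1109.1588 pp. 6–12)] -/
theorem michalakis_zwolak_of_flow_locality_core'
    (hS : ∀ (Φ : (L : ℕ) → Interaction (TorusSite d L × κ) q) (m : ℕ → ℕ) (γ : ℝ) (r₀ : ℕ)
      (Δ γloc : ℕ → ℝ),
      (∀ (L : ℕ) [NeZero L], IsProjectorInteraction (Φ L) ∧ (Φ L).IsLocal) →
      (∀ (L : ℕ) [NeZero L], IsFrustrationFree (Φ L) univ) →
      (∀ (L : ℕ) [NeZero L] (X : Finset (TorusSite d L × κ)), r₀ < torusDiam X → Φ L X = 0) →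
      (0 < γ ∧ ∀ (L : ℕ) [NeZero L], (localHamiltonian (Φ L) univ).HasClusterGap (m L) 0 γ) →
      HasUniformLTQO Φ Δ → HasFastDecay Δ → HasUniformLocalGap Φ γloc →
      (∃ c : ℝ, ∃ p : ℕ, 0 < c ∧ ∀ ℓ : ℕ, c / ((ℓ : ℝ) + 1) ^ p ≤ γloc ℓ) →
      ∀ (r : ℕ) (V : (L : ℕ) → Interaction (TorusSite d L × κ) q),
        (∀ (L : ℕ) [NeZero L], (V L).IsLocal ∧
          (∀ X, r < torusDiam X → V L X = 0) ∧ ∀ X, ‖V L X‖ ≤ 1) →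
        ∀ w : 𝓢(ℝ, ℂ), (∫ t : ℝ, w t) = 1 →
          (∀ D : ℝ, γ / 2 ≤ |D| → ∫ t : ℝ, cexp (t * D * I) * w t = 0) →
          (∀ t : ℝ, starRingEnd ℂ (w t) = w t) →
        ∃ L_A : ℕ, ∃ Bd : ℕ → ℝ,
          ∀ ε : ℝ, |ε| ≤ 1 → ∀ (L : ℕ) [NeZero L], L_A ≤ L → ∀ s ∈ Set.Icc (0 : ℝ) 1,
            (∀ t ∈ Set.Icc (0 : ℝ) s, ∃ ω : ℝ, ω ≤ γ ∧
              (localHamiltonian (Φ L) univ +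
                (t : ℂ) • ((ε : ℂ) • localHamiltonian (V L) univ)).HasClusterGap (m L) ω (γ / 2)) →
            ∃ (U : Op (TorusSite d L × κ) q) (S : Finset (TensorIndex (TorusSite d L × κ) q))
              (c₁ c₂ : Finset (TorusSite d L × κ) → TorusSite d L)
              (A B : Finset (TorusSite d L × κ) → ℕ → Op (TorusSite d L × κ) q),
              U ∈ unitary (Op (TorusSite d L × κ) q) ∧
              (∀ hHs : (∑ Z, Φ L Z + ((s * ε : ℝ) : ℂ) • ∑ Z, V L Z).IsHermitian,
                (∀ k ∈ S, ∀ l ∉ S, γ / 2 ≤ |hHs.eigenvalues k - hHs.eigenvalues l|) ∧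
                star U * projMatrix (Submodule.span ℂ (Set.range fun i : S =>
                  hHs.eigenvectorBasis i)) * U = localGroundProj (Φ L) univ) ∧
              (∀ Z, Φ L Z ≠ 0 → Z ⊆ cellBall (c₁ Z) r₀) ∧
              (∀ Z, V L Z ≠ 0 → Z ⊆ cellBall (c₂ Z) r) ∧
              (∀ Z, Φ L Z ≠ 0 → ∑ ℓ ∈ range (L + 1), A Z ℓ =
                star U * (∫ t : ℝ, w t • heisenbergEvolution
                  (∑ Z, Φ L Z + ((s * ε : ℝ) : ℂ) • ∑ Z, V L Z) t (Φ L Z)) * U -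
                  ∫ t : ℝ, w t • heisenbergEvolution (∑ Z, Φ L Z) t (Φ L Z)) ∧
              (∀ Z, V L Z ≠ 0 → ∑ ℓ ∈ range (L + 1), B Z ℓ =
                star U * (∫ t : ℝ, w t • heisenbergEvolution
                  (∑ Z, Φ L Z + ((s * ε : ℝ) : ℂ) • ∑ Z, V L Z) t (V L Z)) * U) ∧
              (∀ Z ℓ, IsSupportedOn (A Z ℓ) (cellBall (c₁ Z) ℓ)) ∧
              (∀ Z ℓ, IsSupportedOn (B Z ℓ) (cellBall (c₂ Z) ℓ)) ∧
              (∀ Z ℓ, (A Z ℓ).IsHermitian) ∧ (∀ Z ℓ, (B Z ℓ).IsHermitian) ∧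
              (∀ Z ℓ (p : ℕ), ‖A Z ℓ‖ ≤ |ε| * (Bd p / ((ℓ : ℝ) + 1) ^ p)) ∧
              (∀ Z ℓ (p : ℕ), ‖B Z ℓ‖ ≤ Bd p / ((ℓ : ℝ) + 1) ^ p)) :
    michalakis_zwolak (κ := κ) d q := by
  refine michalakis_zwolak_of_flow_decomposition_core d q ?_
  intro Φ m γ r₀ Δ γloc hproj hff hrange hgap hltqo hΔ hloc hγloc r V hV
  have hγ : 0 < γ := hgap.1
  obtain ⟨w, hw1, hw2, hw3⟩ := exists_schwartz_filter (half_pos hγ)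
  obtain ⟨L_A, Bd, hcore⟩ :=
    hS Φ m γ r₀ Δ γloc hproj hff hrange hgap hltqo hΔ hloc hγloc r V hV w hw1 hw2 hw3
  refine ⟨L_A, Bd, ?_⟩
  intro ε hε L _ hL s hs hprev
  obtain ⟨U, S, c₁, c₂, A, B, hU, hflow, hc₁, hc₂, hAsum, hBsum, hAs, hBs, hAh, hBh, hAn, hBn⟩ :=
    hcore ε hε L hL s hs hprev
  -- the Hamiltonians and their hermiticity
  set H₀ : Op (TorusSite d L × κ) q := ∑ Z, Φ L Z with hH₀def
  set Hs : Op (TorusSite d L × κ) q := ∑ Z, Φ L Z + ((s * ε : ℝ) : ℂ) • ∑ Z, V L Z with hHsdef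
  have hH₀eq : localHamiltonian (Φ L) univ = H₀ := localHamiltonian_univ_eq_sum _
  have hH₀h : H₀.IsHermitian := by
    rw [← hH₀eq]; exact localHamiltonian_isHermitian (hproj L).2 univ
  have hV₁h : (∑ Z, V L Z).IsHermitian := by
    rw [← localHamiltonian_univ_eq_sum]; exact localHamiltonian_isHermitian (hV L).1 univ
  have hHsh : Hs.IsHermitian := hH₀h.add (isHermitian_ofReal_smul hV₁h _)
  obtain ⟨hsep, hUP⟩ := hflow hHsh
  have hwi : Integrable (fun t : ℝ => w t) := w.integrable
  -- the smoothing maps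
  set Fs : Op (TorusSite d L × κ) q → Op (TorusSite d L × κ) q :=
    fun O => ∫ t : ℝ, w t • heisenbergEvolution Hs t O with hFsdef
  set F0 : Op (TorusSite d L × κ) q → Op (TorusSite d L × κ) q :=
    fun O => ∫ t : ℝ, w t • heisenbergEvolution H₀ t O with hF0def
  set Ps : Op (TorusSite d L × κ) q :=
    projMatrix (Submodule.span ℂ (Set.range fun i : S => hHsh.eigenvectorBasis i)) with hPsdef
  refine ⟨U, Ps, Fs, F0, c₁, c₂, A, B, hU, hUP, ?_, ?_, ?_, ?_, ?_, ?_, ?_, ?_, hc₁, hc₂,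
    ?_, ?_, hAs, hBs, hAh, hBh, hAn, hBn⟩
  · exact fun X Y => integral_smul_heisenbergEvolution_add hHsh hwi X Y
  · exact fun a X => integral_smul_heisenbergEvolution_smul Hs w a X
  · -- `𝓕^s(H_s) = H_s`
    show (∫ t : ℝ, w t • heisenbergEvolution Hs t Hs) = Hs
    rw [integral_smul_heisenbergEvolution_self, hw1, one_smul]
  · exact fun O => commute_integral_smul_heisenbergEvolution_projMatrix hHsh hwi hw2 S hsep O
  · exact fun X Y => integral_smul_heisenbergEvolution_add hH₀h hwi X Y
  · exact fun a X => integral_smul_heisenbergEvolution_smul H₀ w a X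
  · show (∫ t : ℝ, w t • heisenbergEvolution H₀ t H₀) = H₀
    rw [integral_smul_heisenbergEvolution_self, hw1, one_smul]
  · -- `[𝓕⁰(O), P₀] = 0`: `P₀` is the separated projection onto the eigenvalues `≤ 0`
    intro O
    have hgapL : (localHamiltonian (Φ L) univ).HasClusterGap (m L) 0 γ := hgap.2 L
    have hHh' : (localHamiltonian (Φ L) univ).IsHermitian :=
      localHamiltonian_isHermitian (hproj L).2 univ
    have hsep0 := separated_ground_indices (hproj L).1 hgapL hHh'
    have hsep0' : ∀ k ∈ ({k | hHh'.eigenvalues k ≤ 0} : Finset (TensorIndex (TorusSite d L × κ) q)),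
        ∀ l ∉ ({k | hHh'.eigenvalues k ≤ 0} : Finset (TensorIndex (TorusSite d L × κ) q)),
          γ / 2 ≤ |hHh'.eigenvalues k - hHh'.eigenvalues l| :=
      fun k hk l hl => (half_le_self hγ.le).trans (hsep0 k hk l hl)
    have hc := commute_integral_smul_heisenbergEvolution_projMatrix hHh' hwi hw2 _ hsep0' O
    -- identify the separated projection with `P₀`
    have hP0 : localGroundProj (Φ L) univ = projMatrix (Submodule.span ℂ (Set.range fun i :
        ({k | hHh'.eigenvalues k ≤ 0} : Finset (TensorIndex (TorusSite d L × κ) q)) =>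
          hHh'.eigenvectorBasis i)) := by
      rcases isEmpty_or_nonempty (TensorIndex (TorusSite d L × κ) q) with hemp | hne
      · exact Subsingleton.elim _ _
      · obtain ⟨c₀, p₀, hc₀, hγloc'⟩ := hγloc
        exact localGroundProj_univ_eq_projMatrix_span (hproj L).1 (hloc L) hHh' le_rfl
          (lt_of_lt_of_le (by positivity) (hγloc' L))
    rw [hP0]
    show Commute (∫ t : ℝ, w t • heisenbergEvolution H₀ t O) _
    rw [← hH₀eq]
    exact hc
  · intro Z hZ
    exact hAsum Z hZ
  · intro Z hZ
    exact hBsum Z hZ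

end Core

end Literature.MathematicalPhysics.QuantumLattice
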